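import Literature.NumberTheory.DiophantineGeometry.GenEllMechanismAssembly
import Literature.NumberTheory.DiophantineGeometry.GenEllPhiMechanismPlaces
import Literature.NumberTheory.DiophantineGeometry.GenEllDeCoverFarFromCuspsFamilyPlacesD3
import Literature.NumberTheory.DiophantineGeometry.GenEllDeCoverFarFromCuspsMechanism
import HarnessLib

/-!
# [GenEll] Thm 2.1 for `ℙ¹` at an ARBITRARY finite set of primes `Σ` (W-Σ, piece 1): the
# noncritical-Belyi mechanism of the family `t_c`, assembled under statement (ii) at `Σ = S`

S. Mochizuki, *Arithmetic elliptic curves in general position*, Math. J. Okayama Univ. **52** (2010),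
Thm. 2.1 (ii) ⇒ (i), proof pp. 12–13 [cite: MochizukiGenEll2010, Thm 2.1 p.12]: "Let `Σ` be a finite
set of prime numbers" (p. 11) — the printed theorem is stated for EVERY finite set of primes `Σ`, and the
proof moves the points into "a compactly bounded subset `K_V` whose support contains `Σ`" by asking that
ALL conjugates at `∞` AND AT EVERY `v ∈ Σ` stay away from the fibre over the cusps (p. 12).

The cell's number-field-only architecture (`GENELLTWO-P1ROUTE.md`, abc-iut-S6) was carried out at
`Σ = {2}` (route item `GenEllTwo`, w5-d075's `GenEllMechanismAssembly.vojtaIneq_mechanism_of_condBound`).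
This file is the `Σ`-generic TWIN of that assembly, for the named fact `GenEll_thm21_primes`
(`GenEllThm21.lean`, F-1336): the SAME mechanism `(k, c, ρ_T)` and the SAME per-point bookkeeping, with

* statement (ii) taken at `Σ = S` (`hii : ABCCompactlyBounded S`) instead of `{2}`;
* the separation set `T` far from the roots of the bad polynomial at `∞` and at EVERY `ℓ ∈ S`
  (`hTS`) instead of at `2` only;
* W7 in its places form (w4-d031 lineage, `exists_farFromCusps_phi_c_of_base_places`) and the
  `S`-generic bookkeeping `GenEllPhiMechanismPlaces.vojtaIneq_of_belyi_mechanism_of_subset` (S6).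

Everything else — the per-point field `L_P = F(r)(θ)` (`GenEllMechanismField`), W4a-c
(`Superelliptic.exists_belyi_tFunC_ht_lower`), Prop. 1.7 (i) left (`NFPoint.logCond_sub_logCondDiv_le`)
and right (`logDiff_dePoint_le` + the fixed layer `hD`), the conductor-bound hypothesis `hκ` (the SAME
binder as at `{2}`, so that w5-d045's `GenEll.exists_condBound_mechanism` discharges it verbatim once
`2 ∈ S`) — is consumed BY NAME and unchanged.

* `vojtaIneq_mechanism_of_condBound_of_ne_half_places`, `vojtaIneq_mechanism_of_condBound_places`.

Theorems only; classical ([GenEll] is refereed and outside the IUT dispute, Scholze–Stix 2018 §1.2);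
nothing here bears on [IUTchIII] Cor. 3.12.
-/

noncomputable section

open Polynomial NumberField

namespace Literature.NumberTheory.DiophantineGeometry.GenEll

/-- `t_c · (r(1−2x)) = (1−2x) + c·r^{k+2}` off the poles. [folklore] -/
private theorem tC_mul_eq' {L : Type*} [Field L] (k : ℕ) (c : L) {x r : L} (hr : r ≠ 0)
    (hs : 1 - 2 * x ≠ 0) :
    DeCrit.tC k c x r * (r * (1 - 2 * x)) = (1 - 2 * x) + c * r ^ (k + 2) := by
  unfold DeCrit.tC
  rw [div_mul_cancel₀ _ (mul_ne_zero hr hs)]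

/-- A point `ρ`-far from the cusps (`ρ ≥ 0`) lies in `U`. [folklore] -/
private theorem NFPoint.inU_of_farFromCusps' {S : Finset ℕ} {ρ : ℝ} {P : NFPoint}
    (h : P.FarFromCusps S ρ) (hρ : 0 ≤ ρ) : P.InU := by
  obtain ⟨σ⟩ := (inferInstance : Nonempty (P.F →+* ℂ))
  obtain ⟨h0, -, h1⟩ := h.1 σ
  refine ⟨fun hx => ?_, fun hx => ?_⟩
  · rw [hx, map_zero, norm_zero] at h0
    exact absurd h0 (not_lt.mpr hρ)
  · rw [hx, map_one, sub_self, norm_zero] at h1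
    exact absurd h1 (not_lt.mpr hρ)

/-! ## The mechanism on its separation set at `{∞} ∪ S`, modulo the conductor bound -/

section Mechanism

variable (k : ℕ) (c : ℚ) (φ : P1FiniteMap) (μ : ℚ[X])

/-- **The noncritical-Belyi mechanism `(k, c, ρ_T)` assembled under statement (ii) at `Σ = S`,
modulo the W5 conductor bound** — for points with `x ≠ 1/2`.  Data as in
`vojtaIneq_mechanism_of_condBound_of_ne_half` (`e = 2k+1`, `c ∈ ℚ^×`, `ρ_T = (f : g)` of degree
`n > 0` in S7's currency, `μ` of positive degree), a finite set of primes `S` with statement (ii)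
`ABCCompactlyBounded S`, and a set `T` of points with `x ≠ 1/2` all of whose conjugates at `∞` and at
EVERY `ℓ ∈ S` are `ρ`-far from the roots of `g_bad := Res_r(curvePoly, G_{f g (f−g)})`.  Assume the
conductor bound `hκ` (`≤ B_c·ht P + C₂`, `B_c := ((n+2)(2k+4) − (6k+6))/(2k+1)`), the fixed-layer
different bound `hD`, and the slope inequalities for `A := n(2k+4)/(2k+1)`.  Then `VojtaIneq T d ε`:
the image points `Z P = ρ_T(t_c(x, r))` are far from the cusps at `∞` and at every `ℓ ∈ S`
(W7, places form), hence lie in the annulus compactly bounded subset WITH SUPPORT `{∞} ∪ S`, to which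
(ii) at `Σ = S` applies. [cite: MochizukiGenEll2010, Thm 2.1 proof pp.12–13] -/
theorem vojtaIneq_mechanism_of_condBound_of_ne_half_places {S : Finset ℕ}
    (hS : ∀ ℓ ∈ S, ℓ.Prime) (hii : ABCCompactlyBounded S) (hk : 1 ≤ k) (hc : c ≠ 0)
    (hdeg : 0 < φ.deg) (hnum : φ.num.natDegree = φ.deg) (hden : φ.den.natDegree = φ.deg)
    (hsub : (φ.num - φ.den).natDegree = φ.deg)
    (hcop : IsCoprime (φ.num.map (Int.castRingHom ℚ)) (φ.den.map (Int.castRingHom ℚ)))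
    (hμ : μ.natDegree ≠ 0) {d : ℕ} (hd : 0 < d) {ε ε' ρ : ℝ} (hε' : 0 < ε') (hρ : 0 < ρ)
    (T : Set NFPoint)
    (hTℂ : ∀ P ∈ T, ∀ σ : P.F →+* ℂ, ∀ a ∈ (resultant (De.curvePoly k) (De.homFibrePolyC k c
      (φ.num.map (Int.castRingHom ℚ) * φ.den.map (Int.castRingHom ℚ) *
        (φ.num.map (Int.castRingHom ℚ) - φ.den.map (Int.castRingHom ℚ))))).aroots ℂ,
      ρ < ‖σ P.x - a‖)
    (hTS : ∀ P ∈ T, ∀ ℓ ∈ S, ∀ [Fact ℓ.Prime], ∀ σ : P.F →+* PadicAlgCl ℓ,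
      ∀ a ∈ (resultant (De.curvePoly k) (De.homFibrePolyC k c
      (φ.num.map (Int.castRingHom ℚ) * φ.den.map (Int.castRingHom ℚ) *
        (φ.num.map (Int.castRingHom ℚ) - φ.den.map (Int.castRingHom ℚ))))).aroots (PadicAlgCl ℓ),
      ρ < ‖σ P.x - a‖)
    (hThalf : ∀ P ∈ T, 1 - 2 * P.x ≠ 0)
    {C₂ D : ℝ}
    (hκ : ∀ P ∈ T ∩ UPle d,
      aeval (DeCrit.tC k (algebraMap ℚ (P.mechField (2 * k + 1) μ) c)
          (P.mechPoint (2 * k + 1) μ).x (P.mechRoot (2 * k + 1) μ))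
        (φ.num * φ.den * (φ.num - φ.den)) ≠ 0 →
      (⟨P.mechField (2 * k + 1) μ, DeCrit.tC k (algebraMap ℚ (P.mechField (2 * k + 1) μ) c)
          (P.mechPoint (2 * k + 1) μ).x (P.mechRoot (2 * k + 1) μ)⟩ : NFPoint).logCondDiv
          φ.pullbackCusps ≤
        ((φ.deg + 2 : ℝ) * (2 * k + 4) - (6 * k + 6)) / (2 * k + 1) * P.ht + C₂)
    (hD : ∀ P ∈ T ∩ UPle d,
      (P.mechPoint (2 * k + 1) μ).logDiff ≤ (P.dePoint (2 * k + 1)).logDiff + D)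
    (hslope : 0 < (φ.deg : ℝ) * (2 * k + 4) / (2 * k + 1) -
      (1 + ε') * (((φ.deg + 2 : ℝ) * (2 * k + 4) - (6 * k + 6)) / (2 * k + 1)))
    (hε : (1 + ε') / ((φ.deg : ℝ) * (2 * k + 4) / (2 * k + 1) -
      (1 + ε') * (((φ.deg + 2 : ℝ) * (2 * k + 4) - (6 * k + 6)) / (2 * k + 1))) ≤ 1 + ε) :
    VojtaIneq T d ε := by
  classical
  have he : 0 < 2 * k + 1 := by omega
  -- the rational forms of `f, g` and the bad polynomial
  set pℚ : ℚ[X] := φ.num.map (Int.castRingHom ℚ) with hp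
  set qℚ : ℚ[X] := φ.den.map (Int.castRingHom ℚ) with hq
  have hinj : Function.Injective (Int.castRingHom ℚ) := (Int.castRingHom ℚ).injective_int
  have hpn : pℚ.natDegree = φ.deg := by rw [hp, natDegree_map_eq_of_injective hinj, hnum]
  have hqn : qℚ.natDegree = φ.deg := by rw [hq, natDegree_map_eq_of_injective hinj, hden]
  have hpqn : (pℚ - qℚ).natDegree = φ.deg := by
    rw [hp, hq, ← Polynomial.map_sub, natDegree_map_eq_of_injective hinj, hsub]
  have hp0 : pℚ ≠ 0 := fun h => by rw [h, natDegree_zero] at hpn; omega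
  have hq0 : qℚ ≠ 0 := fun h => by rw [h, natDegree_zero] at hqn; omega
  have hne : pℚ ≠ qℚ := fun h => by rw [h, sub_self, natDegree_zero] at hpqn; omega
  set gbad : ℚ[X] := resultant (De.curvePoly k) (De.homFibrePolyC k c (pℚ * qℚ * (pℚ - qℚ)))
    with hgbad
  -- the degree bound of the auxiliary points
  set N : ℕ := μ.natDegree * ((2 * k + 1) * d) with hN
  have hNpos : 0 < N := Nat.mul_pos (Nat.pos_of_ne_zero hμ) (Nat.mul_pos he hd)
  -- W7 at `{∞} ∪ S` (w4-d031 places lineage): the margin `ρ'` at the image points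
  obtain ⟨ρ', hρ'0, hρ'2, hfar⟩ := exists_farFromCusps_phi_c_of_base_places k hc hpn hqn hpqn hp0
    hq0 hne hρ N S hS (Xℂ := (gbad.aroots ℂ).toFinset)
    (fun P' hc' hr' hs' hfib => Multiset.mem_toFinset.mpr
      (De.fst_mem_aroots_resultant_of_fibre k hc hp0 hq0 hne P' hc' hr' hs' hfib))
    (fun (ℓ : ℕ) [Fact ℓ.Prime] => (gbad.aroots (PadicAlgCl ℓ)).toFinset)
    (fun ℓ _ _ P' hc' hr' hs' hfib => Multiset.mem_toFinset.mpr
      (De.fst_mem_aroots_resultant_of_fibre k hc hp0 hq0 hne P' hc' hr' hs' hfib))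
  -- W4a-c (S4 g3): the height constant `c₁`
  obtain ⟨c₁, hc₁⟩ := Superelliptic.exists_belyi_tFunC_ht_lower k hk c hc hcop hpn.le hqn.le
    (Or.inl hpn)
  -- the auxiliary points `Q P`, `Z P` and the conductor `κ P`
  let tP : (P : NFPoint) → P.mechField (2 * k + 1) μ := fun P =>
    DeCrit.tC k (algebraMap ℚ (P.mechField (2 * k + 1) μ) c) (P.mechPoint (2 * k + 1) μ).x
      (P.mechRoot (2 * k + 1) μ)
  let zP : (P : NFPoint) → P.mechField (2 * k + 1) μ := fun P =>
    aeval (tP P) pℚ / aeval (tP P) qℚ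
  let Q : NFPoint → NFPoint := fun P => P.mechPoint (2 * k + 1) μ
  let Z : NFPoint → NFPoint := fun P => (P.mechPoint (2 * k + 1) μ).imageAt (zP P)
  let κ : NFPoint → ℝ := fun P =>
    (⟨P.mechField (2 * k + 1) μ, tP P⟩ : NFPoint).logCondDiv φ.pullbackCusps
  -- integer forms evaluate as their rational images
  have haeZ : ∀ (P : NFPoint) (F : ℤ[X]) (y : P.mechField (2 * k + 1) μ),
      aeval y (F.map (Int.castRingHom ℚ)) = aeval y F := fun P F y => by
    rw [← algebraMap_int_eq, aeval_map_algebraMap]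
  -- PER-POINT FACTS on `T ∩ U^{≤d}`
  have facts : ∀ P ∈ T ∩ UPle d,
      P.InU ∧ P.mechRoot (2 * k + 1) μ ≠ 0 ∧ 1 - 2 * (P.mechPoint (2 * k + 1) μ).x ≠ 0 ∧
      (tP P * (P.mechRoot (2 * k + 1) μ * (1 - 2 * (P.mechPoint (2 * k + 1) μ).x)) =
        (1 - 2 * (P.mechPoint (2 * k + 1) μ).x) +
          algebraMap ℚ (P.mechField (2 * k + 1) μ) c * P.mechRoot (2 * k + 1) μ ^ (k + 2)) ∧
      NFPoint.FarFromCusps S ρ' ⟨P.mechField (2 * k + 1) μ, zP P⟩ := by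
    intro P hP
    have hPU : P.InU := hP.2.1.1
    have hr : P.mechRoot (2 * k + 1) μ ≠ 0 := P.mechRoot_ne_zero (2 * k + 1) μ hPU he
    have hs : 1 - 2 * (P.mechPoint (2 * k + 1) μ).x ≠ 0 :=
      (P.one_sub_two_mul_mechPoint_x_ne_zero_iff (2 * k + 1) μ).mpr (hThalf P hP.1)
    have hcurve : P.mechRoot (2 * k + 1) μ ^ (2 * k + 1) =
        algebraMap P.F (P.mechField (2 * k + 1) μ) P.x *
          (1 - algebraMap P.F (P.mechField (2 * k + 1) μ) P.x) := P.mechRoot_pow (2 * k + 1) μ he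
    refine ⟨hPU, hr, hs, tC_mul_eq' k _ hr hs, ?_⟩
    exact hfar P
      (fun σ ξ hξ => by
        rw [dist_eq_norm]; exact (hTℂ P hP.1 σ ξ (Multiset.mem_toFinset.mp hξ)).le)
      (fun ℓ hℓ _ σ ξ hξ => by
        rw [dist_eq_norm]; exact (hTS P hP.1 ℓ hℓ σ ξ (Multiset.mem_toFinset.mp hξ)).le)
      (P.mechField (2 * k + 1) μ) (P.degree_mechPoint_le_of_le (2 * k + 1) μ he hμ hP.2.2 le_rfl)
      (algebraMap P.F (P.mechField (2 * k + 1) μ)) (P.mechRoot (2 * k + 1) μ) hcurve hr hs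
  -- the `S`-generic bookkeeping theorem (S6), statement (ii) at `Σ = S`, annulus with support `{∞} ∪ S`
  refine vojtaIneq_of_belyi_mechanism_of_subset hS (Finset.Subset.refl S) hii (T := T) (d := d)
    (d' := N) hNpos hε' hρ'0 hρ'2 Z Q κ
    (A := (φ.deg : ℝ) * (2 * k + 4) / (2 * k + 1))
    (Bc := ((φ.deg + 2 : ℝ) * (2 * k + 4) - (6 * k + 6)) / (2 * k + 1))
    (c₁ := c₁ / (2 * k + 1)) (c₂ := C₂)
    (c₃ := 2 * Real.log (((2 * k + 1) * ((2 * k + 1) * (2 * k + 1).factorial) : ℕ) : ℝ) + D)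
    ?_ ?_ ?_ ?_ ?_ ?_ hslope hε
  · -- hZmem : `Z P ∈ U^{≤N}`
    intro P hP
    obtain ⟨-, -, -, -, hfarP⟩ := facts P hP
    have hzU := NFPoint.inU_of_farFromCusps' hfarP hρ'0.le
    exact (P.mechPoint (2 * k + 1) μ).imageAt_mem_UPle hzU.1 hzU.2
      (P.degree_mechPoint_le_of_le (2 * k + 1) μ he hμ hP.2.2 le_rfl)
  · -- hZfar : W7 at `{∞} ∪ S`
    intro P hP
    obtain ⟨-, -, -, -, hfarP⟩ := facts P hP
    exact NFPoint.farFromCusps_imageAt (P.mechPoint (2 * k + 1) μ) (zP P) hfarP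
  · -- hZht : W4a-c through the `ℙ¹` machine for `ρ_T`
    intro P hP
    obtain ⟨hPU, hr, hs, ht, -⟩ := facts P hP
    have hxU : (P.mechPoint (2 * k + 1) μ).InU := (P.inU_mechPoint_iff (2 * k + 1) μ).mpr hPU
    have ht' : tP P * (P.mechRoot (2 * k + 1) μ * (1 - 2 * (P.mechPoint (2 * k + 1) μ).x)) =
        (1 - 2 * (P.mechPoint (2 * k + 1) μ).x) +
          (c : (P.mechPoint (2 * k + 1) μ).F) * P.mechRoot (2 * k + 1) μ ^ (k + 2) := by
      rw [ht, ← eq_ratCast (algebraMap ℚ (P.mechField (2 * k + 1) μ)) c]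
    have h := hc₁ (P.mechField (2 * k + 1) μ) (P.mechPoint (2 * k + 1) μ).x
      (P.mechRoot (2 * k + 1) μ) (1 - 2 * (P.mechPoint (2 * k + 1) μ).x) (tP P) rfl
      (P.mechRoot_pow (2 * k + 1) μ he) hxU.1 hxU.2 hs ht'
    have e1 : (NFPoint.mk (P.mechField (2 * k + 1) μ) (P.mechPoint (2 * k + 1) μ).x).ht = P.ht :=
      P.ht_mechPoint (2 * k + 1) μ
    have e2 : (Z P).ht = (NFPoint.mk (P.mechField (2 * k + 1) μ) (zP P)).ht :=
      (P.mechPoint (2 * k + 1) μ).ht_imageAt (zP P)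
    rw [e1, ← e2] at h
    exact h
  · -- hZcond : Prop. 1.7 (i) left for `ρ_T` along `ℚ(z) ⊆ F(r)(θ)`
    intro P hP
    obtain ⟨-, -, -, -, hfarP⟩ := facts P hP
    have hzU := NFPoint.inU_of_farFromCusps' hfarP hρ'0.le
    -- `g(t) ≠ 0` since `z = f(t)/g(t) ≠ 0`
    have hqt : aeval (tP P) qℚ ≠ 0 := by
      intro h0
      apply hzU.1
      change aeval (tP P) pℚ / aeval (tP P) qℚ = 0
      rw [h0, div_zero]
    have hmaps : NFPoint.MapsUnder φ (Z P) ⟨P.mechField (2 * k + 1) μ, tP P⟩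
        (NFPoint.imageEmb ⟨P.mechField (2 * k + 1) μ, tP P⟩ (zP P)) := by
      refine ⟨?_, ?_⟩
      · change aeval (tP P) φ.den ≠ 0
        rwa [← haeZ P φ.den]
      · change aeval (tP P) φ.num =
          NFPoint.imageEmb ⟨P.mechField (2 * k + 1) μ, tP P⟩ (zP P)
            ((NFPoint.imageAt ⟨P.mechField (2 * k + 1) μ, tP P⟩ (zP P)).x) * aeval (tP P) φ.den
        rw [NFPoint.imageEmb_x, ← haeZ P φ.num, ← haeZ P φ.den]
        change aeval (tP P) pℚ = aeval (tP P) pℚ / aeval (tP P) qℚ * aeval (tP P) qℚ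
        rw [div_mul_cancel₀ _ hqt]
    have hZU : (Z P).InU := (NFPoint.imageAt_inU_iff _ _).mpr hzU
    have h := NFPoint.logCond_sub_logCondDiv_le hmaps hZU
    have hQt : (⟨P.mechField (2 * k + 1) μ, tP P⟩ : NFPoint).logDiff =
        (P.mechPoint (2 * k + 1) μ).logDiff := rfl
    change (Z P).logDiff + (Z P).logCond ≤ (P.mechPoint (2 * k + 1) μ).logDiff + κ P
    rw [← hQt]
    linarith
  · -- hκ : the W5 conductor bound, at points off the cusp fibre (`f(t)·g(t)·(f−g)(t) ≠ 0`)
    intro P hP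
    obtain ⟨-, -, -, -, hfarP⟩ := facts P hP
    have hzU := NFPoint.inU_of_farFromCusps' hfarP hρ'0.le
    have hpq : aeval (tP P) pℚ ≠ 0 ∧ aeval (tP P) qℚ ≠ 0 := div_ne_zero_iff.mp hzU.1
    have hpq1 : aeval (tP P) pℚ ≠ aeval (tP P) qℚ := by
      intro h
      apply hzU.2
      change aeval (tP P) pℚ / aeval (tP P) qℚ = 1
      rw [h, div_self hpq.2]
    refine hκ P hP ?_
    rw [map_mul, map_mul, map_sub, ← haeZ P φ.num, ← haeZ P φ.den]
    exact mul_ne_zero (mul_ne_zero hpq.1 hpq.2) (sub_ne_zero.mpr hpq1)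
  · -- hQ : Prop. 1.7 (i) right for the Kummer cover, plus the fixed layer `F(r) ⊆ F(r)(θ)`
    intro P hP
    obtain ⟨hPU, -⟩ := facts P hP
    have h1 := hD P hP
    have h2 := P.logDiff_dePoint_le (2 * k + 1) hPU he
    change (P.mechPoint (2 * k + 1) μ).logDiff ≤ _
    linarith

/-- **The mechanism assembled under statement (ii) at `Σ = S`, modulo the W5 conductor bound** (all
points of the separation set at `{∞} ∪ S`: the Weierstrass fibre `x = 1/2` is added back by
`vojtaIneq_of_half`).  Same data and hypotheses as `vojtaIneq_mechanism_of_condBound_of_ne_half_places`,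
the conductor bound and the fixed-layer different bound being required only at the points with
`x ≠ 1/2`; the `Σ`-generic twin of `vojtaIneq_mechanism_of_condBound`.
[cite: MochizukiGenEll2010, Thm 2.1 proof pp.12–13] -/
theorem vojtaIneq_mechanism_of_condBound_places {S : Finset ℕ}
    (hS : ∀ ℓ ∈ S, ℓ.Prime) (hii : ABCCompactlyBounded S) (hk : 1 ≤ k) (hc : c ≠ 0)
    (hdeg : 0 < φ.deg) (hnum : φ.num.natDegree = φ.deg) (hden : φ.den.natDegree = φ.deg)
    (hsub : (φ.num - φ.den).natDegree = φ.deg)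
    (hcop : IsCoprime (φ.num.map (Int.castRingHom ℚ)) (φ.den.map (Int.castRingHom ℚ)))
    (hμ : μ.natDegree ≠ 0) {d : ℕ} (hd : 0 < d) {ε ε' ρ : ℝ} (hε' : 0 < ε') (hρ : 0 < ρ)
    (T : Set NFPoint)
    (hTℂ : ∀ P ∈ T, ∀ σ : P.F →+* ℂ, ∀ a ∈ (resultant (De.curvePoly k) (De.homFibrePolyC k c
      (φ.num.map (Int.castRingHom ℚ) * φ.den.map (Int.castRingHom ℚ) *
        (φ.num.map (Int.castRingHom ℚ) - φ.den.map (Int.castRingHom ℚ))))).aroots ℂ,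
      ρ < ‖σ P.x - a‖)
    (hTS : ∀ P ∈ T, ∀ ℓ ∈ S, ∀ [Fact ℓ.Prime], ∀ σ : P.F →+* PadicAlgCl ℓ,
      ∀ a ∈ (resultant (De.curvePoly k) (De.homFibrePolyC k c
      (φ.num.map (Int.castRingHom ℚ) * φ.den.map (Int.castRingHom ℚ) *
        (φ.num.map (Int.castRingHom ℚ) - φ.den.map (Int.castRingHom ℚ))))).aroots (PadicAlgCl ℓ),
      ρ < ‖σ P.x - a‖)
    {C₂ D : ℝ}
    (hκ : ∀ P ∈ T ∩ UPle d, 1 - 2 * P.x ≠ 0 →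
      aeval (DeCrit.tC k (algebraMap ℚ (P.mechField (2 * k + 1) μ) c)
          (P.mechPoint (2 * k + 1) μ).x (P.mechRoot (2 * k + 1) μ))
        (φ.num * φ.den * (φ.num - φ.den)) ≠ 0 →
      (⟨P.mechField (2 * k + 1) μ, DeCrit.tC k (algebraMap ℚ (P.mechField (2 * k + 1) μ) c)
          (P.mechPoint (2 * k + 1) μ).x (P.mechRoot (2 * k + 1) μ)⟩ : NFPoint).logCondDiv
          φ.pullbackCusps ≤
        ((φ.deg + 2 : ℝ) * (2 * k + 4) - (6 * k + 6)) / (2 * k + 1) * P.ht + C₂)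
    (hD : ∀ P ∈ T ∩ UPle d, 1 - 2 * P.x ≠ 0 →
      (P.mechPoint (2 * k + 1) μ).logDiff ≤ (P.dePoint (2 * k + 1)).logDiff + D)
    (hslope : 0 < (φ.deg : ℝ) * (2 * k + 4) / (2 * k + 1) -
      (1 + ε') * (((φ.deg + 2 : ℝ) * (2 * k + 4) - (6 * k + 6)) / (2 * k + 1)))
    (hε : (1 + ε') / ((φ.deg : ℝ) * (2 * k + 4) / (2 * k + 1) -
      (1 + ε') * (((φ.deg + 2 : ℝ) * (2 * k + 4) - (6 * k + 6)) / (2 * k + 1))) ≤ 1 + ε) :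
    VojtaIneq T d ε := by
  -- the points with `x ≠ 1/2`
  have hmain := vojtaIneq_mechanism_of_condBound_of_ne_half_places k c φ μ hS hii hk hc hdeg hnum
    hden hsub hcop hμ hd hε' hρ (T ∩ {P : NFPoint | 1 - 2 * P.x ≠ 0})
    (fun P hP => hTℂ P hP.1) (fun P hP => hTS P hP.1) (fun P hP => hP.2)
    (C₂ := C₂) (D := D)
    (fun P hP => hκ P ⟨hP.1.1, hP.2⟩ hP.1.2) (fun P hP => hD P ⟨hP.1.1, hP.2⟩ hP.1.2) hslope hε
  -- the points with `x = 1/2`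
  have hεpos : 0 ≤ 1 + ε := by
    have h1 : 0 < 1 + ε' := by linarith
    have h2 := div_pos h1 hslope
    linarith
  have hhalf := vojtaIneq_of_half (d := d) hεpos
  -- union
  have hunion : VojtaIneq ((T ∩ {P : NFPoint | 1 - 2 * P.x ≠ 0}) ∪ {P : NFPoint | 1 - 2 * P.x = 0})
      d ε := by
    unfold VojtaIneq at hmain hhalf ⊢
    rw [Set.union_inter_distrib_right]
    exact bdLe_union_iff.mpr ⟨hmain, hhalf⟩
  refine hunion.mono (Set.inter_subset_inter_left _ fun P hP => ?_)
  by_cases h : 1 - 2 * P.x = 0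
  · exact Or.inr h
  · exact Or.inl ⟨hP, h⟩

end Mechanism

end Literature.NumberTheory.DiophantineGeometry.GenEll

end
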